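import Literature.AlgebraicGeometry.Frobenioids.RationalFunctionSubfunctors
import Literature.AlgebraicGeometry.Frobenioids.RlfHomEquivariant
import Literature.AlgebraicGeometry.Frobenioids.RealActionGroupification
import Literature.AnabelianGeometry.EtaleTheta.RealificationFunctor
import HarnessLib

/-!
# Frobenioids I, Def. 2.4 (i) / Prop. 5.3: the `ℝ`-vector space `(M^rlf)^gp` and THE realification data
# `(Φ^rlf, Φ^pf → Φ^rlf, ℝ ↷ (Φ^rlf)^gp)` of a perf-factorial monoid `Φ` on a category

Mochizuki, *The geometry of Frobenioids I*, Kyushu J. Math. **62** (2008), §2, Definition 2.4 (i) p. 48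
("`(M^rlf)^gp ⊆ (M^rlf_factor)^gp = ∏_{𝔭 ∈ Prime(M)} (M^rlf_𝔭)^gp` is an `ℝ`-vector space") and §5,
Proposition 5.3 p. 103 ("Suppose that `Φ` is perf-factorial. Then we shall refer to as the realification `C^rlf`
of the Frobenioid `C` the model Frobenioid [cf. Theorem 5.2, (ii)] associated to the divisor monoid `Φ^rlf`
[i.e., the 'realification' of Definition 2.4, (i)] and the rational function monoid `ℝ · Φ^birat ⊆ (Φ^rlf)^gp`
[i.e., for `A_D ∈ Ob(D)`, `(ℝ · Φ^birat)(A_D)` is the `ℝ`-vector subspace of `(Φ^rlf)^gp(A_D)` generated by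
`Φ^birat(A_D)`]") [cite: MochizukiFrdI2008, Def. 2.4(i) p.48] [cite: MochizukiFrdI2008, Prop. 5.3 p.103].

The tree's interface for this data is `structure RealificationData Φ` (`RationalFunctionSubfunctors.lean`,
seat abc-iut-L1-t5; "TODO-merge: abc-iut-L1-t2 … to be instantiated by that seat's functor"): fields
`rlf : Dᵒᵖ ⥤ CommMonCat` (`Φ^rlf`), `pfToRlf : Φ^pf ⟶ Φ^rlf`, the `ℝ`-action `rsmul` on the `(Φ^rlf(X))^gp` with
`rsmul_add/mul/one`, and `ℝ`-linearity of the pull-backs `pullGp_rsmul`; everything realified downstream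
(`R.RlfModelOf Ψ`, `R.realSpan Ψ = ℝ · Ψ`, `C^rlf`, [EtTh] Def. 3.6 `ℝ · Φ₀^cnst`, [IUTchI] Ex. 5.1 (vii)) is
parametrised by an `R : RealificationData Φ`.  This file CONSTRUCTS THE instance for every `Φ` with
perf-factorial values:

* `IsPerfFactorial.Rlf.realSMul h r : (M^rlf)^gp →* (M^rlf)^gp` — the `ℝ`-vector-space structure of
  Def. 2.4 (i), from the `ℝ_{≥0}`-powers (`RealificationRPow.lean`) by `RealAction.gpSMul`
  (`RealActionGroupification.lean`); laws `realSMul_add/zero/neg/one/mul`, `realSMul_coe_of`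
  (`r • [a] = [a^r]` for `r ≥ 0`), and `ℝ`-linearity of `φ^gp` for EVERY homomorphism `φ : M^rlf → N^rlf`
  (`map_realSMul`, from the automatic equivariance `Rlf.map_rpow` of `RlfHomEquivariant.lean`);
* `RealificationData.pfToRlfNatTrans Φ hΦ : Φ^pf ⟶ Φ^rlf` (components `M^pf → M^rlf`, natural by the defining
  property of `rlfMap`, `RealificationFunctor.lean`, seat abc-iut-L2-d2);
* **`RealificationData.canonical Φ hΦ : RealificationData Φ`** with `rlf := rlfFunctor Φ hΦ`, and the check
  `canonical_toRlf : (canonical Φ hΦ).toRlf = toRlfNatTrans Φ hΦ` (`Φ → Φ^pf → Φ^rlf`).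

No statement of the paper is re-typed; this instantiates an existing interface (merge debt I3 of
plan/L1/ASSIGNMENTS.md).  Seat abc-iut-L1-d2 (cell abc-iut), row «FrdI:Def2.4(ii)-ℝ-action + I3-MERGE»
(L1-lead R45 (4)).
-/

noncomputable section

namespace Literature.AlgebraicGeometry.Frobenioids

open CategoryTheory Opposite Function Literature.AnabelianGeometry.EtaleTheta

universe w v u

/-! ### The `ℝ`-vector space `(M^rlf)^gp` -/

namespace IsPerfFactorial

namespace Rlf

variable {M : Type w} [CommMonoid M] (h : IsPerfFactorial M)
variable {N : Type w} [CommMonoid N] (hN : IsPerfFactorial N)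

/-- **`r • (−)` on `(M^rlf)^gp`**, `r ∈ ℝ`: `r • [a] = [a^{r⁺}] / [a^{r⁻}]` — the `ℝ`-vector-space structure of
Def. 2.4 (i) p. 48 on the groupification of the realification. [cite: MochizukiFrdI2008, Def. 2.4(i) p.48] -/
def realSMul (r : ℝ) : Algebra.GrothendieckGroup h.Rlf →* Algebra.GrothendieckGroup h.Rlf :=
  RealAction.gpSMul (rpow h) r

/-- `r • [a] = [a^r]` for `r ≥ 0`: the `ℝ`-action extends the powers of `M^rlf`.
[cite: MochizukiFrdI2008, Def. 2.4(i) p.48] -/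
theorem realSMul_coe_of (r : NNReal) (a : h.Rlf) :
    realSMul h (r : ℝ) (Algebra.GrothendieckGroup.of a) = Algebra.GrothendieckGroup.of (rpow h r a) :=
  RealAction.gpSMul_coe_of (rpow h) (rpow_add h) (rpow_zero h) r a

/-- `r • [a] = [a^{r⁺}] / [a^{r⁻}]` (the defining formula). [cite: MochizukiFrdI2008, Def. 2.4(i) p.48] -/
theorem realSMul_of (r : ℝ) (a : h.Rlf) :
    realSMul h r (Algebra.GrothendieckGroup.of a) =
      Algebra.GrothendieckGroup.of (rpow h r.toNNReal a) / Algebra.GrothendieckGroup.of (rpow h (-r).toNNReal a) :=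
  RealAction.gpSMul_of (rpow h) r a

/-- `(r + s) • ξ = (r • ξ)(s • ξ)`. [cite: MochizukiFrdI2008, Def. 2.4(i) p.48] -/
theorem realSMul_add (r s : ℝ) (ξ : Algebra.GrothendieckGroup h.Rlf) :
    realSMul h (r + s) ξ = realSMul h r ξ * realSMul h s ξ :=
  RealAction.gpSMul_add (rpow h) (rpow_add h) r s ξ

/-- `0 • ξ = 1`. [cite: MochizukiFrdI2008, Def. 2.4(i) p.48] -/
theorem realSMul_zero (ξ : Algebra.GrothendieckGroup h.Rlf) : realSMul h 0 ξ = 1 :=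
  RealAction.gpSMul_zero (rpow h) (rpow_add h) (rpow_zero h) ξ

/-- `(−r) • ξ = (r • ξ)⁻¹`. [cite: MochizukiFrdI2008, Def. 2.4(i) p.48] -/
theorem realSMul_neg (r : ℝ) (ξ : Algebra.GrothendieckGroup h.Rlf) : realSMul h (-r) ξ = (realSMul h r ξ)⁻¹ :=
  RealAction.gpSMul_neg (rpow h) (rpow_add h) r ξ

/-- `1 • ξ = ξ`. [cite: MochizukiFrdI2008, Def. 2.4(i) p.48] -/
theorem realSMul_one (ξ : Algebra.GrothendieckGroup h.Rlf) : realSMul h 1 ξ = ξ :=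
  RealAction.gpSMul_one (rpow h) (rpow_add h) (rpow_zero h) (rpow_one h) ξ

/-- `(r s) • ξ = r • (s • ξ)`. [cite: MochizukiFrdI2008, Def. 2.4(i) p.48] -/
theorem realSMul_mul (r s : ℝ) (ξ : Algebra.GrothendieckGroup h.Rlf) :
    realSMul h (r * s) ξ = realSMul h r (realSMul h s ξ) :=
  RealAction.gpSMul_mul (rpow h) (rpow_add h) (rpow_mul h) r s ξ

/-- **`φ^gp` is `ℝ`-linear for EVERY homomorphism `φ : M^rlf → N^rlf`** (`M`, `N` perf-factorial):
`φ^gp(r • ξ) = r • φ^gp(ξ)` — by the automatic `ℝ_{≥0}`-equivariance of `φ` (`Rlf.map_rpow`).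
[cite: MochizukiFrdI2008, Def. 2.4(i) p.48] -/
theorem map_realSMul (φ : h.Rlf →* hN.Rlf) (r : ℝ) (ξ : Algebra.GrothendieckGroup h.Rlf) :
    MonGp.map φ (realSMul h r ξ) = realSMul hN r (MonGp.map φ ξ) :=
  RealAction.monGpMap_gpSMul (rpow h) (rpow hN) φ (fun r a => map_rpow h hN φ r a) r ξ

/-- The same for any homomorphism `ψ : (M^rlf)^gp → (N^rlf)^gp` lying over some `φ : M^rlf → N^rlf`.
[cite: MochizukiFrdI2008, Def. 2.4(i) p.48] -/
theorem map_realSMul' (φ : h.Rlf →* hN.Rlf)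
    (ψ : Algebra.GrothendieckGroup h.Rlf →* Algebra.GrothendieckGroup hN.Rlf)
    (hψ : ∀ a, ψ (Algebra.GrothendieckGroup.of a) = Algebra.GrothendieckGroup.of (φ a))
    (r : ℝ) (ξ : Algebra.GrothendieckGroup h.Rlf) : ψ (realSMul h r ξ) = realSMul hN r (ψ ξ) :=
  RealAction.map_gpSMul (rpow h) (rpow hN) φ (fun r a => map_rpow h hN φ r a) ψ hψ r ξ

/-- Every element of `(M^rlf)^gp` is `[a] / [b]` with `a, b ∈ M^rlf` (so the `ℝ`-vector space `(M^rlf)^gp`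
is generated by the image of `M^rlf`). [cite: MochizukiFrdI2008, Def. 2.4(i) p.48] -/
theorem gp_exists_eq_div (ξ : Algebra.GrothendieckGroup h.Rlf) :
    ∃ a b : h.Rlf, ξ = Algebra.GrothendieckGroup.of a / Algebra.GrothendieckGroup.of b := by
  obtain ⟨⟨a, b⟩, hx⟩ := (Localization.monoidOf (⊤ : Submonoid h.Rlf)).surj ξ
  exact ⟨a, b, eq_div_iff_mul_eq'.mpr hx⟩

end Rlf

end IsPerfFactorial

/-! ### THE realification data of a perf-factorial monoid on a category -/

namespace RealificationData

variable {D : Type u} [Category.{v} D] (Φ : Dᵒᵖ ⥤ CommMonCat.{w})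
  (hΦ : ∀ X : Dᵒᵖ, IsPerfFactorial (Φ.obj X))

/-- **`Φ^pf ⟶ Φ^rlf`**, the natural transformation with components the factorization homomorphisms
`Φ(X)^pf → Φ(X)^rlf` (Def. 2.4 (i)(c)); naturality is the defining property of `Φ^rlf(f) = rlfMap`
(`rlfMap_comp_toRealification`). [cite: MochizukiFrdI2008, Prop. 5.3 p.103] -/
def pfToRlfNatTrans : perfectionFunctor Φ ⟶ rlfFunctor Φ hΦ where
  app X := CommMonCat.ofHom (hΦ X).toRealification
  naturality X Y f := by
    apply CommMonCat.hom_ext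
    change (hΦ Y).toRealification.comp (Perfection.map (Φ.map f).hom) =
      (rlfMap Φ hΦ f).comp (hΦ X).toRealification
    exact (rlfMap_comp_toRealification Φ hΦ f).symm

/-- Components of `Φ^pf ⟶ Φ^rlf`. [cite: MochizukiFrdI2008, Prop. 5.3 p.103] -/
@[simp] theorem pfToRlfNatTrans_app_hom (X : Dᵒᵖ) :
    ((pfToRlfNatTrans Φ hΦ).app X).hom = (hΦ X).toRealification := rfl

/-- **THE realification data `(Φ^rlf, Φ^pf → Φ^rlf, ℝ ↷ (Φ^rlf)^gp)`** of a monoid `Φ` on `D` with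
perf-factorial values (Prop. 5.3: "the divisor monoid `Φ^rlf` [i.e., the 'realification' of Definition 2.4,
(i)]"): the instance of the interface `RealificationData Φ` with `rlf := Φ^rlf = rlfFunctor Φ hΦ`,
`pfToRlf :=` the factorization homomorphisms, `rsmul :=` the `ℝ`-vector-space structure `realSMul` of the
`(Φ(X)^rlf)^gp`, whose pull-backs are `ℝ`-linear by `map_realSMul`. [cite: MochizukiFrdI2008, Prop. 5.3 p.103] -/
def canonical : RealificationData Φ where
  rlf := rlfFunctor Φ hΦ
  pfToRlf := pfToRlfNatTrans Φ hΦ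
  rsmul X r := IsPerfFactorial.Rlf.realSMul (hΦ (op X)) r
  rsmul_add X r s x := IsPerfFactorial.Rlf.realSMul_add (hΦ (op X)) r s x
  rsmul_mul X r s x := IsPerfFactorial.Rlf.realSMul_mul (hΦ (op X)) r s x
  rsmul_one X x := IsPerfFactorial.Rlf.realSMul_one (hΦ (op X)) x
  pullGp_rsmul f r x := IsPerfFactorial.Rlf.map_realSMul (hΦ (op _)) (hΦ (op _)) (rlfMap Φ hΦ f.op) r x

/-- `(canonical Φ hΦ).rlf = Φ^rlf`. [cite: MochizukiFrdI2008, Prop. 5.3 p.103] -/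
@[simp] theorem canonical_rlf : (canonical Φ hΦ).rlf = rlfFunctor Φ hΦ := rfl

/-- `(canonical Φ hΦ).pfToRlf` is `Φ^pf ⟶ Φ^rlf`. [cite: MochizukiFrdI2008, Prop. 5.3 p.103] -/
@[simp] theorem canonical_pfToRlf : (canonical Φ hΦ).pfToRlf = pfToRlfNatTrans Φ hΦ := rfl

/-- `(canonical Φ hΦ).rsmul X r` is the `ℝ`-vector-space structure `realSMul` of `(Φ(X)^rlf)^gp`.
[cite: MochizukiFrdI2008, Prop. 5.3 p.103] -/
@[simp] theorem canonical_rsmul (X : D) (r : ℝ) :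
    (canonical Φ hΦ).rsmul X r = IsPerfFactorial.Rlf.realSMul (hΦ (op X)) r := rfl

/-- For `r ≥ 0` the action on `[a]`, `a ∈ Φ(X)^rlf`, is the power: `r • [a] = [a^r]`.
[cite: MochizukiFrdI2008, Prop. 5.3 p.103] -/
theorem canonical_rsmul_coe_of (X : D) (r : NNReal) (a : (hΦ (op X)).Rlf) :
    (canonical Φ hΦ).rsmul X (r : ℝ) (Algebra.GrothendieckGroup.of a) =
      Algebra.GrothendieckGroup.of (IsPerfFactorial.Rlf.rpow (hΦ (op X)) r a) :=
  IsPerfFactorial.Rlf.realSMul_coe_of (hΦ (op X)) r a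

/-- **The natural map `Φ → Φ^rlf` of THE realification data is `Φ → Φ^pf → Φ^rlf`** (= the natural
transformation `toRlfNatTrans` of `RealificationFunctor.lean`). [cite: MochizukiFrdI2008, Prop. 5.3 p.103] -/
theorem canonical_toRlf : (canonical Φ hΦ).toRlf = toRlfNatTrans Φ hΦ := by
  ext X : 2
  rfl

/-- Components of `Φ → Φ^rlf` for THE realification data: `a ↦ (factorization of the image of `a` in
`Φ(X)^pf`)`. [cite: MochizukiFrdI2008, Prop. 5.3 p.103] -/
theorem canonical_toRlf_app_hom (X : Dᵒᵖ) (a : Φ.obj X) :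
    ((canonical Φ hΦ).toRlf.app X).hom a = (hΦ X).toRealification (Perfection.of _ a) := rfl

end RealificationData

end Literature.AlgebraicGeometry.Frobenioids
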